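import Summits.QuantumFields.QCD.Theses.NestedDissectionSea
import Summits.QuantumFields.QCD.Theorems.CoerciveSea.Negative.SeilerBothSides
import Summits.QuantumFields.QCD.Theorems.NegativeCellsDilute.Negative.PinWindow
import Summits.QuantumFields.QCD.Theorems.RobustYangMillsHandover.Negative.SchemeAsymptotics

/-!
# Crux `NegativeCellsDilute` (stmt-QuantumFields-13900), negative side — no uniform pin;
# the pin drives the critical-mass datum to `(−∞, 0]`

Support file of the standing disprover (refuter-cdisprove-stmt-QuantumFields-13900-g2-0, cycle 2),
companion of `PinWindow.lean` / `CellPositivity.lean`. Proved here (sorry-free, standard axioms):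

* `not_pin_at_of_lt_neg_eight`: at probe mass `< −8` the pin event `Re det D_W < 0` is empty
  (mirror Seiler positivity, `CoerciveSeaNegative.fermionDet_wilsonDirac_re_pos_of_pos_or_lt`),
  so the pin inequality `1/4 ≤ P` fails for every torus, coupling and weight;
* `not_uniform_pin`: clause (b) of the crux with its quantifiers `∀ M > M₀` / `∀ᶠ k` SWAPPED
  (uniformity in the depth `M`, body verbatim) is false for EVERY regularisation, mass tuple,
  threshold and size — at a step `k` of the eventual range the depth
  `M = max (M₀+1) ((mcrit k + 9) Z_m(k)/a_k)` has probe `< −8`;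
* `not_negativeCellsDilute_uniformPin`: hence the NATURAL STRENGTHENING of the crux with the
  uniform pin (rest verbatim) is false — the order `∀ M, ∀ᶠ k` is load-bearing, `k₀` must grow
  with `M` (physically: the probe `mcrit − a_k M/Z_m` must stay inside the physical branch);
* `mcrit_eventually_lt`: clause (b) (verbatim) together with `HasMassScaling` (`N_f ≤ 16`) forces
  `mcrit k < η` eventually for every `η > 0` (`limsup mcrit ≤ 0`): the upper pin window
  `mcrit k ≤ a_k M/Z_m(k)` of `PinWindow.lean` closes because `Z_m(k) → ∞`
  (`RobustYangMillsHandover.Negative.tendsto_massIncrement_zero`).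
-/

noncomputable section

namespace Summit.QuantumFields.QCD.Theorems.NegativeCellsDiluteUniformPinFalse

open MeasureTheory Filter Matrix
open Literature.MathematicalPhysics.QuantumLattice Literature.MathematicalPhysics.QuantumFieldTheory
  Literature.Probability.LatticeModels

/-! ## The pin event is empty below `−8` -/

/-- At probe mass `μ < −8` the pin event `Re det D_W(U, μ, 1) < 0` is EMPTY (mirror Seiler
positivity), so the phase-quenched pin ratio is `0` and `1/4 ≤ P` fails, for every torus, coupling
and weight. [folklore] -/
theorem not_pin_at_of_lt_neg_eight {N : ℕ} [NeZero N] (β : ℝ) {μ : ℝ} (hμ : μ < -8)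
    (wt : GaugeConfig 4 N (Matrix.specialUnitaryGroup (Fin 3) ℂ) → ℝ) :
    ¬ ((1 / 4 : ℝ) ≤ (∫ U, (if (fermionDet (wilsonDirac (fundamentalRep (Fin 3)) U μ 1)).re < 0
        then (1 : ℝ) else 0) * wt U
          ∂(wilsonMeasure (d := 4) (L := N) (fundamentalRep (Fin 3)) β)) /
      (∫ U, wt U ∂(wilsonMeasure (d := 4) (L := N) (fundamentalRep (Fin 3)) β))) := by
  have h0 : ∀ U : GaugeConfig 4 N (Matrix.specialUnitaryGroup (Fin 3) ℂ),
      (if (fermionDet (wilsonDirac (fundamentalRep (Fin 3)) U μ 1)).re < 0 then (1 : ℝ) else 0) = 0 := by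
    intro U
    rw [if_neg]
    exact not_lt.mpr (CoerciveSeaNegative.fermionDet_wilsonDirac_re_pos_of_pos_or_lt _
      (fun g => fundamentalRep_mem_unitaryGroup g) U (Or.inr hμ)).le
  simp only [h0, zero_mul, integral_zero, zero_div]
  norm_num

/-- At a fixed step `k`, any depth `M ≥ (mcrit k + 9) Z_m(k) / a_k` puts the probe mass below `−8`.
[folklore] -/
theorem probe_lt_neg_eight {Nf : ℕ} (reg : QCDRegularisation Nf) (k : ℕ) {M : ℝ}
    (hM : (reg.mcrit k + 9) * reg.Zm k / reg.a k ≤ M) :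
    reg.mcrit k - reg.a k * M / reg.Zm k < -8 := by
  have ha := reg.a_pos k
  have hZ := reg.Zm_pos k
  rw [div_le_iff₀ ha] at hM
  have h1 : reg.mcrit k + 9 ≤ reg.a k * M / reg.Zm k := by
    rw [le_div_iff₀ hZ]
    linarith
  linarith

/-! ## No uniform pin -/

/-- **No uniform pin.** Clause (b) of `NegativeCellsDilute` with `∀ M > M₀` and `∀ᶠ k` SWAPPED
(body verbatim) is false for every regularisation `reg`, mass tuple `m`, threshold `M₀` and size
`R`: the eventual range is non-empty, every step admits a torus (`exists_admissible_S`), and the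
depth `max (M₀ + 1) ((mcrit k + 9) Z_m(k)/a_k)` has an empty pin event. [folklore] -/
theorem not_uniform_pin {Nf : ℕ} (reg : QCDRegularisation Nf) (m : Fin Nf → ℝ) (M₀ R : ℝ) :
    ¬ (∀ᶠ k : ℕ in Filter.atTop, ∀ M : ℝ, M₀ < M → ∀ S : ℕ, R ≤ reg.a k * (2 * S + 1) →
      let N : ℕ := 2 * S + 1
      let mq : Fin Nf → ℝ := fun f => reg.mcrit k + reg.a k * m f / reg.Zm k
      let wt : GaugeConfig 4 N (Matrix.specialUnitaryGroup (Fin 3) ℂ) → ℝ :=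
        fun U => ∏ f, ‖fermionDet (wilsonDirac (fundamentalRep (Fin 3)) U (mq f) 1)‖
      (1 / 4 : ℝ) ≤ (∫ U, (if (fermionDet (wilsonDirac (fundamentalRep (Fin 3)) U
          (reg.mcrit k - reg.a k * M / reg.Zm k) 1)).re < 0 then (1 : ℝ) else 0) * wt U
            ∂(wilsonMeasure (d := 4) (L := N) (fundamentalRep (Fin 3)) (reg.β k))) /
        (∫ U, wt U ∂(wilsonMeasure (d := 4) (L := N) (fundamentalRep (Fin 3)) (reg.β k)))) := by
  intro h
  obtain ⟨k, hk⟩ := h.exists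
  obtain ⟨S, hS⟩ := NegativeCellsDilutePinWindow.exists_admissible_S reg R k
  have hM₀ : M₀ < max (M₀ + 1) ((reg.mcrit k + 9) * reg.Zm k / reg.a k) :=
    lt_of_lt_of_le (lt_add_one M₀) (le_max_left _ _)
  have hprobe : reg.mcrit k - reg.a k * max (M₀ + 1) ((reg.mcrit k + 9) * reg.Zm k / reg.a k) /
      reg.Zm k < -8 :=
    probe_lt_neg_eight reg k (le_max_right _ _)
  exact not_pin_at_of_lt_neg_eight (reg.β k) hprobe _ (hk _ hM₀ S hS)

section Crux

open scoped Classical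

/-- **The uniformly-pinned crux is false.** `NegativeCellsDilute` with clause (b) made uniform in
the depth `M` (quantifier swap; everything else VERBATIM) fails: instantiate `Nf = 2`,
`m ≡ M₀ + 1` and apply `not_uniform_pin`. A natural strengthening of the crux, refuted; the crux
itself (with `∀ M > M₀, ∀ᶠ k`) is untouched. [folklore] -/
theorem not_negativeCellsDilute_uniformPin :
    ¬ (∀ Nf : ℕ, (Nf = 2 ∨ Nf = 3) → ∃ reg : QCDRegularisation Nf, reg.HasMassScaling ∧ (reg.scheme 0 0 0).HasAsymptoticScaling ∧ ∃ M₀ : ℝ, 0 ≤ M₀ ∧ ∃ b₀ : ℕ, 2 ≤ b₀ ∧ ∃ ℓ : ℝ, 0 < ℓ ∧ ∀ m : Fin Nf → ℝ, (∀ f, M₀ < m f) → ∃ R : ℝ, 0 < R ∧ (∀ ε : ℝ, 0 < ε → ∀ᶠ k : ℕ in Filter.atTop, ∀ S : ℕ, R ≤ reg.a k * (2 * S + 1) → let N : ℕ := 2 * S + 1; let mq : Fin Nf → ℝ := fun f => reg.mcrit k + reg.a k * m f / reg.Zm k; let wt : GaugeConfig 4 N (Matrix.specialUnitaryGroup (Fin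 3) ℂ) → ℝ := fun U => ∏ f, ‖fermionDet (wilsonDirac (fundamentalRep (Fin 3)) U (mq f) 1)‖; let P : (GaugeConfig 4 N (Matrix.specialUnitaryGroup (Fin 3) ℂ) → Prop) → ℝ := fun E => (∫ U, (if E U then (1 : ℝ) else 0) * wt U ∂(wilsonMeasure (d := 4) (L := N) (fundamentalRep (Fin 3)) (reg.β k))) / (∫ U, wt U ∂(wilsonMeasure (d := 4) (L := N) (fundamentalRep (Fin 3)) (reg.β k))); let J : ℕ := Nat.log 2 (⌊ℓ / reg.a k⌋₊ / b₀) + 1; ∃ δ : ℕ → ℝ, ∑ j ∈ Finset.range J, δ j ≤ ε ∧ ∀ j < J, ∀ s : Fin 4 → ℕ, (∀ i, b₀ * 2 ^ j ≤ s i ∧ s i < b₀ * 2 ^ (j + 2) ∧ s i ≤ N ∧ (s i : ℝ) * reg.a k ≤ ℓ) → P (fun U => ∃ f, IsSignDefect U (mq f) j s) ≤ δ j) ∧ (∀ᶠ k : ℕ in Filter.atTop, ∀ M : ℝ, M₀ < M → ∀ S : ℕ, R ≤ reg.a k * (2 * S + 1) → let N : ℕ := 2 * S + 1; let mq : Fin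 Nf → ℝ := fun f => reg.mcrit k + reg.a k * m f / reg.Zm k; let wt : GaugeConfig 4 N (Matrix.specialUnitaryGroup (Fin 3) ℂ) → ℝ := fun U => ∏ f, ‖fermionDet (wilsonDirac (fundamentalRep (Fin 3)) U (mq f) 1)‖; (1 / 4 : ℝ) ≤ (∫ U, (if (fermionDet (wilsonDirac (fundamentalRep (Fin 3)) U (reg.mcrit k - reg.a k * M / reg.Zm k) 1)).re < 0 then (1 : ℝ) else 0) * wt U ∂(wilsonMeasure (d := 4) (L := N) (fundamentalRep (Fin 3)) (reg.β k))) / (∫ U, wt U ∂(wilsonMeasure (d := 4) (L := N) (fundamentalRep (Fin 3)) (reg.β k))))) := by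
  intro h
  obtain ⟨reg, -, -, M₀, -, b₀, -, ℓ, -, h⟩ := h 2 (Or.inl rfl)
  obtain ⟨R, -, -, hb⟩ := h (fun _ => M₀ + 1) (fun _ => lt_add_one M₀)
  exact not_uniform_pin reg _ M₀ R hb

end Crux

/-! ## The pin drives `mcrit` to `(−∞, 0]` -/

/-- **`limsup mcrit ≤ 0` for pinned admissible regularisations.** If clause (b) of the crux
(VERBATIM, as in `PinWindow.pin_window`) holds for `reg` with `HasMassScaling` (`N_f ≤ 16`), then
for every `η > 0`, eventually `mcrit k < η`: the upper pin window `mcrit k ≤ a_k (M₀+1)/Z_m(k)`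
closes since `a_k/Z_m(k) → 0`. [folklore] -/
theorem mcrit_eventually_lt {Nf : ℕ} (hNf : Nf ≤ 16) {reg : QCDRegularisation Nf}
    (hms : reg.HasMassScaling) {m : Fin Nf → ℝ} {M₀ R : ℝ}
    (h : ∀ M : ℝ, M₀ < M → ∀ᶠ k : ℕ in Filter.atTop, ∀ S : ℕ, R ≤ reg.a k * (2 * S + 1) →
      let N : ℕ := 2 * S + 1
      let mq : Fin Nf → ℝ := fun f => reg.mcrit k + reg.a k * m f / reg.Zm k
      let wt : GaugeConfig 4 N (Matrix.specialUnitaryGroup (Fin 3) ℂ) → ℝ :=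
        fun U => ∏ f, ‖fermionDet (wilsonDirac (fundamentalRep (Fin 3)) U (mq f) 1)‖
      (1 / 4 : ℝ) ≤ (∫ U, (if (fermionDet (wilsonDirac (fundamentalRep (Fin 3)) U
          (reg.mcrit k - reg.a k * M / reg.Zm k) 1)).re < 0 then (1 : ℝ) else 0) * wt U
            ∂(wilsonMeasure (d := 4) (L := N) (fundamentalRep (Fin 3)) (reg.β k))) /
        (∫ U, wt U ∂(wilsonMeasure (d := 4) (L := N) (fundamentalRep (Fin 3)) (reg.β k))))
    {η : ℝ} (hη : 0 < η) : ∀ᶠ k : ℕ in Filter.atTop, reg.mcrit k < η := by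
  have h1 := NegativeCellsDilutePinWindow.pin_window h (lt_add_one M₀)
  have h2 := RobustYangMillsHandover.Negative.tendsto_massIncrement_zero hNf reg hms (M₀ + 1)
  filter_upwards [h1, (tendsto_order.mp h2).2 η hη] with k hk hk'
  linarith

/-- Crux-level reading: any witness `reg` of `NegativeCellsDilute` has `mcrit k < η` eventually,
for every `η > 0` (projection + `mcrit_eventually_lt`; with `PinWindow` also `≥ −8 − o(1)`).
[folklore] -/
theorem mcrit_eventually_lt_of_crux (h : Theses.NestedDissectionSea.NegativeCellsDilute) :
    ∀ Nf : ℕ, (Nf = 2 ∨ Nf = 3) → ∃ reg : QCDRegularisation Nf, reg.HasMassScaling ∧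
      (reg.scheme 0 0 0).HasAsymptoticScaling ∧ (∃ M₀ : ℝ, 0 ≤ M₀ ∧ ∀ M : ℝ, M₀ < M →
        ∀ᶠ k : ℕ in Filter.atTop, reg.mcrit k - reg.a k * M / reg.Zm k ≤ 0) ∧
      ∀ η : ℝ, 0 < η → ∀ᶠ k : ℕ in Filter.atTop, reg.mcrit k < η := by
  intro Nf hNf
  have hNf16 : Nf ≤ 16 := by rcases hNf with rfl | rfl <;> norm_num
  obtain ⟨reg, hms, has, M₀, hM₀, b₀, -, ℓ, -, h⟩ := h Nf hNf
  obtain ⟨R, -, -, hb⟩ := h (fun _ => M₀ + 1) (fun _ => lt_add_one M₀)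
  refine ⟨reg, hms, has, ⟨M₀, hM₀, fun M hM => ?_⟩, fun η hη => mcrit_eventually_lt hNf16 hms hb hη⟩
  exact NegativeCellsDilutePinWindow.pin_window hb hM

end Summit.QuantumFields.QCD.Theorems.NegativeCellsDiluteUniformPinFalse

end
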